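import Mathlib
import HarnessLib
import Summits.NavierStokesRegularity.NavierStokesRegularity.Theorems.HalfSpaceWindowDoorCirculationCarryingRigidityEddyTorqueLiouville

/-!
# Route `HalfSpaceWindowDoor`, crux `CirculationCarryingRigidity` (stmt-NavierStokesRegularity-25311) — the eddy-torque census
# theorem, FAR-PAST form: hypotheses at times `t < s₁` suffice

Line `eddy_torque` (LEAD ns-hsw-p1 g4).  A Liouville-type statement should only need far-past information, and the eddy-torque
theorem does: if the TIME-SHIFT `τ ↦ v(τ + s₁)` (`s₁ ≤ 0`) of a door-class profile satisfies the hypotheses of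
`…EddyTorqueLiouville.inner_curl_e3_eq_zero_of_axisTypeI_remainder_le` — i.e. for times `t < s₁` the profile obeys the
axis-Type-I bound with apex `s₁` (`‖v(t,x)‖ ≤ D/(|x_h| + √(s₁ − t))`, WEAKER than the apex-`0` bound), is closed-hemisphere and
its fluctuation remainder is slaved to the circle-integrated vertical vorticity, `|ℛ| ≤ A/(r + √(s₁ − s))·∮ω₃ dl` — then
`⟪curl v, e₃⟫ ≡ 0` on the WHOLE slab: the shifted profile is a door-class profile (g2's `timeShift_class`), so it is poloidal,
so `ω₃ = 0` at all times `< s₁`, hence everywhere by unique continuation (joint real-analyticity; g2's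
`…HemisphereSupport.inner_curl_e3_eq_zero_of_open`).  Census row: «EVENTUALLY (in the far past) eddy-torque-slaved
closed-hemisphere axis-Type-I profiles are poloidal».

Seat ns-hsw-p1 g4 (LEAD of 25311, cell pub-ns-dss).  WHAT THIS IS NOT: not a statement about Navier–Stokes regularity;
HYPOTHETICAL blow-up profiles; the crux, its stub and NS regularity remain OPEN; helper `--supports` 25311.
-/

noncomputable section

-- the summit and its single sub-problem share the name (CONVENTIONS §1), as in every Theorems file
set_option linter.dupNamespace false

namespace Summit.NavierStokesRegularity.NavierStokesRegularity.Theorems.HalfSpaceWindowDoorCirculationCarryingRigidityEddyTorqueFarPast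

open MeasureTheory Set Function Filter Topology TopologicalSpace InnerProductSpace WithLp Metric
open scoped RealInnerProductSpace ContDiff
open Literature.Analysis Literature.Analysis.FluidPDE Literature.Analysis.UnboundedOperators
open Summit.NavierStokesRegularity.NavierStokesRegularity.Theorems.AxisTwistDoorAveragedConeLiouvilleDefs (vortCirc remainder)
open Summit.NavierStokesRegularity.NavierStokesRegularity.Theorems.HalfSpaceWindowDoorCirculationCarryingRigidityEddyTorqueLiouville
  (inner_curl_e3_eq_zero_of_axisTypeI_remainder_le)
open Summit.NavierStokesRegularity.NavierStokesRegularity.Theorems.HalfSpaceWindowDoorCirculationCarryingRigidityCriticalStretchingAnalytic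
  (timeShift_class)
open Summit.NavierStokesRegularity.NavierStokesRegularity.Theorems.HalfSpaceWindowDoorCirculationCarryingRigidityHemisphereSupport
  (inner_curl_e3_eq_zero_of_open)

/-- **FAR-PAST FORM OF THE EDDY-TORQUE CENSUS THEOREM.**  Let `v` be a profile of the door's Type-I ancient Oseen-mild class and
`s₁ ≤ 0`.  If its time-shift `w(τ) = v(τ + s₁)` obeys the axis-Type-I bound `‖w(τ,x)‖ ≤ D/(|x_h| + √(−τ))`, the
closed-hemisphere sign, and the eddy-torque condition `|ℛ_w(r,z,τ)| ≤ A/(r + √(−τ)) ∮ω₃(w) dl` (all three involve `v` only at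
times `< s₁`), then `⟪curl v, e₃⟫ ≡ 0` on the whole open slab. -/
theorem inner_curl_e3_eq_zero_of_farPast_axisTypeI_remainder_le (C D A : ℝ)
    (v : ℝ → EuclideanSpace ℝ (Fin 3) → EuclideanSpace ℝ (Fin 3))
    (hrate : HasTypeITimeDecay C v)
    (hcont : ContinuousOn (uncurry v) (Iio (0 : ℝ) ×ˢ univ))
    (hmild : ∀ s t : ℝ, s < t → t < 0 → ∀ x, v t x = heatExtension (v s) (t - s) x - oseenDuhamel 1 s v v t x)
    (hdiv : ∀ t < 0, VectorCalculus.IsDivFree (v t)) {s₁ : ℝ} (hs₁ : s₁ ≤ 0)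
    (hDax : ∀ τ < 0, ∀ x : EuclideanSpace ℝ (Fin 3), ‖v (τ + s₁) x‖ ≤ D / (cylRadius x + Real.sqrt (-τ)))
    (hsign : ∀ τ < 0, ∀ y, 0 ≤ ⟪curl (v (τ + s₁)) y, (EuclideanSpace.single (2 : Fin 3) (1 : ℝ))⟫_ℝ)
    (hA : 0 ≤ A)
    (hrem : ∀ τ < 0, ∀ r : ℝ, 0 < r → ∀ z : ℝ,
      |remainder (fun τ' => v (τ' + s₁)) r z τ| ≤ A / (r + Real.sqrt (-τ)) * vortCirc (fun τ' => v (τ' + s₁)) r z τ) :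
    ∀ s < 0, ∀ y, ⟪curl (v s) y, (EuclideanSpace.single (2 : Fin 3) (1 : ℝ))⟫_ℝ = 0 := by
  -- the shifted profile is a door-class profile and satisfies the census hypotheses, hence is poloidal
  obtain ⟨hrate', hcont', hmild', hdiv'⟩ := timeShift_class hrate hcont hmild hdiv hs₁
  have hw : ∀ τ < 0, ∀ y, ⟪curl ((fun τ' => v (τ' + s₁)) τ) y, (EuclideanSpace.single (2 : Fin 3) (1 : ℝ))⟫_ℝ = 0 :=
    inner_curl_e3_eq_zero_of_axisTypeI_remainder_le C D A (fun τ' => v (τ' + s₁)) hrate' hcont' hmild' hdiv' hDax hsign hA hrem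
  -- so `ω₃ = 0` at all times `< s₁`: an open non-empty subset of the slab
  have hv : ∀ t < s₁, ∀ y, ⟪curl (v t) y, (EuclideanSpace.single (2 : Fin 3) (1 : ℝ))⟫_ℝ = 0 := by
    intro t ht y
    have h := hw (t - s₁) (by linarith) y
    simpa using h
  have hO : IsOpen (Iio s₁ ×ˢ (univ : Set (EuclideanSpace ℝ (Fin 3)))) := isOpen_Iio.prod isOpen_univ
  have hne : (Iio s₁ ×ˢ (univ : Set (EuclideanSpace ℝ (Fin 3)))).Nonempty :=
    ⟨(s₁ - 1, 0), mk_mem_prod (by simp) (mem_univ _)⟩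
  have hsub : Iio s₁ ×ˢ (univ : Set (EuclideanSpace ℝ (Fin 3))) ⊆ Iio (0 : ℝ) ×ˢ univ :=
    prod_mono (Iio_subset_Iio hs₁) Subset.rfl
  exact inner_curl_e3_eq_zero_of_open hrate hcont hmild hO hne hsub fun p hp => hv p.1 hp.1 p.2

end Summit.NavierStokesRegularity.NavierStokesRegularity.Theorems.HalfSpaceWindowDoorCirculationCarryingRigidityEddyTorqueFarPast

end
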